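import Summits.ABC.IUTFork.Cor312LicenceTripleHullCellRefuteTame
import Summits.ABC.IUTFork.Conditional.AbcOfSGenuineKLinUniformRows6
import Summits.ABC.IUTFork.Conditional.WRowFrey31117999167337103924704RefBandSixtySeven
import HarnessLib

/-!
# R-W «W:REF-BANDS-EXACT», OVERLAP triple 2: `2⁴⁶·23 + 3⁹·5⁵·11⁷·31²·43 = 19¹¹·59·7207` — the hull-level clause S_H is REFUTED at EVERY genuine
# Θ-volume datum for EVERY prime level `5 ≤ l ≤ 148535`, `l ≠ 19`, over the WHOLE kernel class `e(K_x/ℚ₁₉) ∈ {15·l, 30·l}` (deciding pole `p = 19`)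

PROOF-ONLY file (D-0012; 0 definitions, 0 `Prop` facts, no instance) of the abc-iut cell — D-0079 RESCUE sub-cell R-W «WINDOW Θ-SIDE INEQUALITY»,
seat abc-iut-W-neg-1 (gen 4), row «W:REF-BANDS-EXACT» (abc-iut-plan C-R83 (c); second of the two OVERLAP triples of the R-W numerics lead's GAP-EXACT.tsv
b6df69e4392b55b6: refuted certificate to `l = 148,533`, inhabited certificate from `l = 148,532`). TAKES NO SIDE on [IUTchIII] Cor. 3.12 (S. Mochizuki,
*Inter-universal Teichmüller theory III*, Cor. 3.12 p. 173–174; Step (xi-f) p. 184) or on any author; «refuted as typed» ≠ «refuted in print».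

THE ARITHMETIC (desk files work/cert.py, work/poly.py of this seat; REF-BANDS-EXACT-CERTS.tsv 368bd85925fe47bb row «19 11 30»). At `p = 19`: `19¹¹ ∥ c`,
`v₁₉(abc) = 11` is ODD and coprime to `15`, so the kernel class of the engine `Cor312LicenceTripleHullCellRefuteTame` (`A ∣ 30`, `15 ∣ 11A`) is
`A ∈ {15, 30}` (the R-W numerics lead's desk rule «`t` odd, `p ∣ c` ⇒ `{2e₀}` = `{30}`» — the ramified twist of the Legendre curve — is NOT used: BOTH
members are refuted, so the theorem needs NO local-type input at all). Top-label hull cells (`j = (l−1)/2`), with `l = 2k + 3` and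
`18·⌊A·l/18⌋ ≤ A·l`, `18·(cell slack)` bounded below by a polynomial `D(k) ≥ 0` on each turning-point piece:
`A = 30` (`P_q = 330`): `a₀ = 1` (`l ≤ 11`) `3720k²+4452k−5994`; `a₀ = 2` (`12 ≤ l ≤ 216`) `2640k²+6828k+3078`; `a₀ = 3` (`217 ≤ l ≤ 4115`)
`1560k²+120012k+233766`; `a₀ = 4` (`4116 ≤ l ≤ 78192`) `480k²+2338548k+4675158`; `a₀ = 5` (`78193 ≤ l ≤ 148535`) `−600k²+44558772k+89119926`
(concave; `D(39095) = 825,062,896,266`, `D(74266) = 27,627,678`; the exact cell first holds at `l = 148,539`);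
`A = 15` (`P_q = 165`): four pieces `a₀ ≤ 4` (`l ≤ 22 / 433 / 8230 / 148535`), all certificates convex with positive values on their pieces.
Hence for EVERY prime `5 ≤ l ≤ 148,535`, `l ≠ 19`: S_H FAILS at every genuine Θ-volume datum over `(ratPoint (a/c), l)` — extending abc-iut-W-num-6's e-free
[LIN] band `GenuineK.not_pilotKummerCompatHull_chosen_frey1618481116086272_band` (`6 ≤ l ≤ 78192`, `AbcOfSGenuineKLinUniformBandRows6`) by the factor `1.9`.

WHAT IS PROVED (namespace `Summit.ABC.IUTFork.Conditional`): §1 `WRow.factorization_frey1618481116086272_nineteen` (`v₁₉ = 11`),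
`WRow.refBandClass_nineteen_eleven` (class `{15, 30}`), `WRow.refBandCells_frey1618481116086272_nineteen_thirty` / `…_fifteen` (failing cells per member);
§2 **`WRow.not_licence_frey1618481116086272_refBand`** / **`WRow.not_exists_qPinned_and_hull_frey1618481116086272_refBand`** /
**`GenuineK.not_pilotKummerCompatHull_chosen_frey1618481116086272_refBand`** — EVERY prime `5 ≤ l ≤ 148535`, `l ≠ 19`, EVERY genuine Θ-volume datum at
`(ratPoint (a/c), l)`: the three W-lane shapes, NO local-type hypothesis.
READING (neutral; numbers, not adjectives): the R-W table's refuted side for this triple is ONE theorem on the whole band, ∀T over BOTH class members; the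
level `l = 19` and the levels `l > 148,535` are NOT covered here (R-W numerics: inhabited certificate from `l = 148,532`). Admissibility / Szpiro-badness /
(P6) / NON-EMPTINESS of `(ratPoint (a/c), l)` are NOT claimed. HONEST SCOPE: OUR sharp containers and Dupuy–Hilado's typed (Ind1)/(Ind2); STRONGER-THAN-PRINT
hull reading; nothing about the printed inequality, the number-level corollary or any author's intended hull; typed ≠ proved; instantiated ≠ endorsed; no abc
claim. [cite: Mochizuki2012, IUTchI Ex. 3.2 (iv) p. 71; IUTchIII Cor. 3.12 Step (xi-f) p. 184; IUTchIV Prop. 1.1 p. 9, Prop. 1.2 (i)(ii) p. 10, Cor. 2.2 (ii) proof (P5) p. 46]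
[cite: DupuyHilado2025, §3.3, §3.4, §4.9, §4.12] [cite: SilvermanAEC2009, Prop. III.1.7(b)] [claim: Mochizuki2012, status: disputed] for every IUT sentence.
-/

noncomputable section

open Set Function Metric NumberField IsDedekindDomain

namespace Summit.ABC.IUTFork.Conditional

open Thm311 Thm311.Real Cor312 Cor312Vol Cor312Prov Literature.IUT.LogThetaLattice Literature.IUT.LogVolume
  Literature.IUT.HodgeTheaters Literature.IUT.LogVolume.Cor22 Literature.IUT.LogVolume.ThetaData
open Literature.NumberTheory.NumberFields Literature.NumberTheory.GaloisRepresentations.Ultrametric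
open Literature.NumberTheory.DiophantineGeometry Literature.NumberTheory.DiophantineGeometry.GenEll
open Summit.ABC.IUTFork.Repair.RH.HullThresholdExact Summit.ABC.IUTFork.Repair.RH.HullThresholdExactRefute

/-! ## §1. Arithmetic: `v₁₉(abc) = 11`, the class `{15, 30}`, and the failing top-label cells for both members -/

/-- `v_p(n) = k` from `n = p^k·m` with `p ∤ m`. [folklore] -/
private theorem factorization_eq_of_eq_pow_mul₁₉ {p k m n : ℕ} (hp : p.Prime) (hn : n = p ^ k * m) (hm : ¬ p ∣ m) :
    n.factorization p = k := by
  subst hn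
  have hm0 : m ≠ 0 := fun h => hm (h ▸ dvd_zero p)
  rw [Nat.factorization_mul (pow_ne_zero _ hp.ne_zero) hm0, Finsupp.add_apply, hp.factorization_pow, Finsupp.single_eq_same,
    Nat.factorization_eq_zero_of_not_dvd hm, add_zero]

/-- `v₁₉(abc) = 11` for `abc = (2⁴⁶·23)·(3⁹·5⁵·11⁷·31²·43)·(19¹¹·59·7207)` (`19¹¹ ∥ c`). [folklore] -/
theorem WRow.factorization_frey1618481116086272_nineteen :
    (2 ^ 46 * 23 * (3 ^ 9 * 5 ^ 5 * 11 ^ 7 * 31 ^ 2 * 43) * (19 ^ 11 * 59 * 7207)).factorization 19 = 11 :=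
  factorization_eq_of_eq_pow_mul₁₉ (m := 2 ^ 46 * 23 * (3 ^ 9 * 5 ^ 5 * 11 ^ 7 * 31 ^ 2 * 43) * (59 * 7207)) (by norm_num) (by ring) (by norm_num)

/-- **The kernel class at `(p, v) = (19, 11)` is `{15, 30}`**: `A ∣ 30` and `15 ∣ 11·A` (so `15 ∣ A`) force `A = 15 ∨ A = 30`. [folklore] -/
theorem WRow.refBandClass_nineteen_eleven {A : ℕ} (h30 : A ∣ 30) (h15 : 15 ∣ A * 11) : A = 15 ∨ A = 30 := by
  obtain ⟨k, rfl⟩ := Nat.Coprime.dvd_of_dvd_mul_right (by norm_num : Nat.Coprime 15 11) h15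
  have hk : k ∣ 2 := Nat.dvd_of_mul_dvd_mul_left (by norm_num : 0 < 15) (by simpa using h30)
  rcases (Nat.dvd_prime Nat.prime_two).mp hk with rfl | rfl
  · exact Or.inl rfl
  · exact Or.inr rfl

/-- **The failing cells, member `A = 30`** (`P_q = 330`, top label, `r_in = ⌊30l/18⌋ + 1`, `r_out = 19^{a₀} − a₀·30l`), EVERY odd `5 ≤ l ≤ 148535`: five turning-point
pieces, each ONE `nlinarith` on the polynomial certificate of the module docstring (floor-free sufficient condition `WRow.not_hullCell_of_le`). [folklore] -/
theorem WRow.refBandCells_frey1618481116086272_nineteen_thirty (l : ℕ) (h5 : 5 ≤ l) (hhi : l ≤ 148535) (hodd : l % 2 = 1) :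
    ∃ a₀ : ℕ, (∀ s : ℕ, s < a₀ → (1 : ℤ) * ((19 : ℕ) : ℤ) ^ s * (((19 : ℕ) : ℤ) - 1) < ((30 * l : ℕ) : ℤ)) ∧
      ((30 * l : ℕ) : ℤ) ≤ 1 * ((19 : ℕ) : ℤ) ^ a₀ * (((19 : ℕ) : ℤ) - 1) ∧
      ¬ HullCell ((30 * l : ℕ) : ℤ) ((30 * 11 : ℕ) : ℤ) ((((l - 1) / 2 - 1 : ℕ) : ℤ) + 1) (((30 * l) / ((19 : ℕ) - 1) + 1 : ℕ) : ℤ)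
        (((19 : ℕ) : ℤ) ^ a₀ - (a₀ : ℤ) * ((30 * l : ℕ) : ℤ)) := by
  have hk : 2 * ((l - 1) / 2 - 1) + 3 = l := by omega
  have hr : 18 * (30 * l / ((19 : ℕ) - 1)) ≤ 30 * l := by omega
  generalize (l - 1) / 2 - 1 = k at hk ⊢
  generalize 30 * l / ((19 : ℕ) - 1) = r at hr ⊢
  have hkz : (2 * k + 3 : ℤ) = l := by exact_mod_cast hk
  have hrz : (18 * r : ℤ) ≤ 30 * l := by exact_mod_cast hr
  have hk0 : (0 : ℤ) ≤ k := by positivity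
  rcases le_or_gt l 11 with h1 | h1
  · refine ⟨1, fun s hs => ?_, ?_, WRow.not_hullCell_of_le (by positivity) ?_⟩
    · interval_cases s; push_cast; omega
    · push_cast; omega
    · have hk1 : (1 : ℤ) ≤ k := by linarith
      push_cast
      nlinarith [mul_nonneg hk0 (sub_nonneg.2 hrz), sub_nonneg.2 hrz, mul_nonneg (sub_nonneg.2 hk1) (sub_nonneg.2 hk1)]
  rcases le_or_gt l 216 with h2 | h2
  · refine ⟨2, fun s hs => ?_, ?_, WRow.not_hullCell_of_le (by positivity) ?_⟩
    · interval_cases s <;> push_cast <;> omega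
    · push_cast; omega
    · have hlo : (12 : ℤ) ≤ l := by exact_mod_cast h1
      have hk1 : (4 : ℤ) ≤ k := by linarith
      push_cast
      nlinarith [mul_nonneg hk0 (sub_nonneg.2 hrz), sub_nonneg.2 hrz, mul_nonneg (sub_nonneg.2 hk1) (sub_nonneg.2 hk1)]
  rcases le_or_gt l 4115 with h3 | h3
  · refine ⟨3, fun s hs => ?_, ?_, WRow.not_hullCell_of_le (by positivity) ?_⟩
    · interval_cases s <;> push_cast <;> omega
    · push_cast; omega
    · have hlo : (217 : ℤ) ≤ l := by exact_mod_cast h2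
      have hk1 : (107 : ℤ) ≤ k := by linarith
      push_cast
      nlinarith [mul_nonneg hk0 (sub_nonneg.2 hrz), sub_nonneg.2 hrz, mul_nonneg (sub_nonneg.2 hk1) (sub_nonneg.2 hk1)]
  rcases le_or_gt l 78192 with h4 | h4
  · refine ⟨4, fun s hs => ?_, ?_, WRow.not_hullCell_of_le (by positivity) ?_⟩
    · interval_cases s <;> push_cast <;> omega
    · push_cast; omega
    · have hlo : (4116 : ℤ) ≤ l := by exact_mod_cast h3
      have hk1 : (2056 : ℤ) ≤ k := by linarith
      push_cast
      nlinarith [mul_nonneg hk0 (sub_nonneg.2 hrz), sub_nonneg.2 hrz, mul_nonneg (sub_nonneg.2 hk1) (sub_nonneg.2 hk1)]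
  · refine ⟨5, fun s hs => ?_, ?_, WRow.not_hullCell_of_le (by positivity) ?_⟩
    · interval_cases s <;> push_cast <;> omega
    · push_cast; omega
    · have hlo : (78193 : ℤ) ≤ l := by exact_mod_cast h4
      have hhiz : (l : ℤ) ≤ 148535 := by exact_mod_cast hhi
      have hk1 : (39095 : ℤ) ≤ k := by linarith
      have hk2 : (k : ℤ) ≤ 74266 := by linarith
      push_cast
      nlinarith [mul_nonneg hk0 (sub_nonneg.2 hrz), sub_nonneg.2 hrz, mul_nonneg (sub_nonneg.2 hk1) (sub_nonneg.2 hk2),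
        sub_nonneg.2 hk1, sub_nonneg.2 hk2]

/-- **The failing cells, member `A = 15`** (`P_q = 165`, top label, `r_in = ⌊15l/18⌋ + 1`, `r_out = 19^{a₀} − a₀·15l`), EVERY odd `5 ≤ l ≤ 148535`: four turning-point
pieces (`a₀ ≤ 4`), each ONE `nlinarith` on the polynomial certificate of the module docstring. [folklore] -/
theorem WRow.refBandCells_frey1618481116086272_nineteen_fifteen (l : ℕ) (h5 : 5 ≤ l) (hhi : l ≤ 148535) (hodd : l % 2 = 1) :
    ∃ a₀ : ℕ, (∀ s : ℕ, s < a₀ → (1 : ℤ) * ((19 : ℕ) : ℤ) ^ s * (((19 : ℕ) : ℤ) - 1) < ((15 * l : ℕ) : ℤ)) ∧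
      ((15 * l : ℕ) : ℤ) ≤ 1 * ((19 : ℕ) : ℤ) ^ a₀ * (((19 : ℕ) : ℤ) - 1) ∧
      ¬ HullCell ((15 * l : ℕ) : ℤ) ((15 * 11 : ℕ) : ℤ) ((((l - 1) / 2 - 1 : ℕ) : ℤ) + 1) (((15 * l) / ((19 : ℕ) - 1) + 1 : ℕ) : ℤ)
        (((19 : ℕ) : ℤ) ^ a₀ - (a₀ : ℤ) * ((15 * l : ℕ) : ℤ)) := by
  have hk : 2 * ((l - 1) / 2 - 1) + 3 = l := by omega
  have hr : 18 * (15 * l / ((19 : ℕ) - 1)) ≤ 15 * l := by omega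
  generalize (l - 1) / 2 - 1 = k at hk ⊢
  generalize 15 * l / ((19 : ℕ) - 1) = r at hr ⊢
  have hkz : (2 * k + 3 : ℤ) = l := by exact_mod_cast hk
  have hrz : (18 * r : ℤ) ≤ 15 * l := by exact_mod_cast hr
  have hk0 : (0 : ℤ) ≤ k := by positivity
  rcases le_or_gt l 22 with h1 | h1
  · refine ⟨1, fun s hs => ?_, ?_, WRow.not_hullCell_of_le (by positivity) ?_⟩
    · interval_cases s; push_cast; omega
    · push_cast; omega
    · have hk1 : (1 : ℤ) ≤ k := by linarith
      push_cast
      nlinarith [mul_nonneg hk0 (sub_nonneg.2 hrz), sub_nonneg.2 hrz, mul_nonneg (sub_nonneg.2 hk1) (sub_nonneg.2 hk1)]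
  rcases le_or_gt l 433 with h2 | h2
  · refine ⟨2, fun s hs => ?_, ?_, WRow.not_hullCell_of_le (by positivity) ?_⟩
    · interval_cases s <;> push_cast <;> omega
    · push_cast; omega
    · have hlo : (23 : ℤ) ≤ l := by exact_mod_cast h1
      have hk1 : (10 : ℤ) ≤ k := by linarith
      push_cast
      nlinarith [mul_nonneg hk0 (sub_nonneg.2 hrz), sub_nonneg.2 hrz, mul_nonneg (sub_nonneg.2 hk1) (sub_nonneg.2 hk1)]
  rcases le_or_gt l 8230 with h3 | h3
  · refine ⟨3, fun s hs => ?_, ?_, WRow.not_hullCell_of_le (by positivity) ?_⟩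
    · interval_cases s <;> push_cast <;> omega
    · push_cast; omega
    · have hlo : (434 : ℤ) ≤ l := by exact_mod_cast h2
      have hk1 : (215 : ℤ) ≤ k := by linarith
      push_cast
      nlinarith [mul_nonneg hk0 (sub_nonneg.2 hrz), sub_nonneg.2 hrz, mul_nonneg (sub_nonneg.2 hk1) (sub_nonneg.2 hk1)]
  · refine ⟨4, fun s hs => ?_, ?_, WRow.not_hullCell_of_le (by positivity) ?_⟩
    · interval_cases s <;> push_cast <;> omega
    · push_cast; omega
    · have hlo : (8231 : ℤ) ≤ l := by exact_mod_cast h3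
      have hk1 : (4114 : ℤ) ≤ k := by linarith
      push_cast
      nlinarith [mul_nonneg hk0 (sub_nonneg.2 hrz), sub_nonneg.2 hrz, mul_nonneg (sub_nonneg.2 hk1) (sub_nonneg.2 hk1)]

/-! ## §2. The band: S_H REFUTED at every genuine datum, every prime `5 ≤ l ≤ 148535`, `l ≠ 19`, BOTH class members -/

/-- **«W:REF-BANDS-EXACT», OVERLAP TRIPLE 2, licence level**: `2⁴⁶·23 + 3⁹·5⁵·11⁷·31²·43 = 19¹¹·59·7207`, EVERY prime `5 ≤ l ≤ 148535` with `l ≠ 19`, EVERY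
genuine Θ-volume datum `T` at `(ratPoint (a/c), l)`, EVERY pair of Θ- and q-ideles realising the pilot divisors of `X := pilotDataOfK T.D T.K`: abc-iut-c312-1's
`Thm311ToCor312.Licence` FAILS at abc-iut-c312-7's `settingPrVolSharp X …` — the class-robust engine `WRow.not_licence_triple_of_hullCells_tame` (p496736) at
`(p, v, i) = (19, 11, (l−1)/2 − 1)` with the class `{15, 30}` and the cells of §1 for BOTH members; NO local-type hypothesis.
[cite: Mochizuki2012, IUTchI Ex. 3.2 (iv) p. 71; IUTchIII Cor. 3.12 Step (xi-f) p. 184; IUTchIV Prop. 1.1 p. 9, Prop. 1.2 (i)(ii) p. 10, Cor. 2.2 (ii) proof (P5) p. 46]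
[cite: DupuyHilado2025, §3.4, §4.9, §4.12] [claim: Mochizuki2012, status: disputed] -/
theorem WRow.not_licence_frey1618481116086272_refBand {l : ℕ} (hl : l.Prime) (h5 : 5 ≤ l) (hhi : l ≤ 148535) (h19 : l ≠ 19)
    (T : Cor22.ThetaVolumeDatumAt (ratPoint (((2 ^ 46 * 23 : ℕ) : ℚ) / (19 ^ 11 * 59 * 7207 : ℕ))) l) :
    letI := T.instFieldF; letI := T.instNumberFieldF; letI := T.instAlgebraF; letI := T.instFieldK
    letI := T.instNumberFieldK; letI := T.instAlgebraK; letI := T.instFieldFbar; letI := T.instAlgebraFbar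
    letI := T.instAlgebraKFbar; letI := T.instIsElliptic
    ∀ {logv : PadicLogs T.K} (hlog : LogvAnalytic logv) (M : Type) [Field M] [NumberField M]
      (archPk : ∀ (j : (thetaIndex (pilotDataOfK T.D T.K)).Label) (vQ : (thetaIndex (pilotDataOfK T.D T.K)).VQ),
        Set ((logShellsDH (pilotDataOfK T.D T.K) logv).Packet j vQ))
      (archSub : ∀ (j : (thetaIndex (pilotDataOfK T.D T.K)).Label) (v : (thetaIndex (pilotDataOfK T.D T.K)).V),
        Set ((logShellsDH (pilotDataOfK T.D T.K) logv).Packet j ((thetaIndex (pilotDataOfK T.D T.K)).over v)))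
      (Ψ : ℤ → ∀ v : (thetaIndex (pilotDataOfK T.D T.K)).V, v ∈ (thetaIndex (pilotDataOfK T.D T.K)).Vbad →
        Set ((logShellsDH (pilotDataOfK T.D T.K) logv).StarPacket v))
      (act : ℤ → ∀ v : (thetaIndex (pilotDataOfK T.D T.K)).V, v ∈ (thetaIndex (pilotDataOfK T.D T.K)).Vbad →
        (logShellsDH (pilotDataOfK T.D T.K) logv).StarPacket v → Module.End ℚ ((logShellsDH (pilotDataOfK T.D T.K) logv).StarPacket v))
      (Mmod : ℤ → ∀ j : (thetaIndex (pilotDataOfK T.D T.K)).LabelStar, Set ((logShellsDH (pilotDataOfK T.D T.K) logv).GlobalPacket j.1))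
      (region : ℤ → ∀ j : (thetaIndex (pilotDataOfK T.D T.K)).LabelStar, FinDivisor M → ∀ vQ : (thetaIndex (pilotDataOfK T.D T.K)).VQ,
        Set ((logShellsDH (pilotDataOfK T.D T.K) logv).Packet j.1 vQ))
      (n : ℤ) {HT : Type} {LogLink : HT → HT → Type} {IsFull : ∀ {s t : HT}, LogLink s t → Prop}
      (lat : LGPGaussianLogThetaLattice LogLink IsFull)
      {Frd : Type} {IsoF : Frd → Frd → Type} {Ob : Frd → Type} {realify : Frd → Frd} {Strip : Type}
      {IsoS : Strip → Strip → Type} {Mv : ∀ v : (thetaIndex (pilotDataOfK T.D T.K)).V, v ∈ (thetaIndex (pilotDataOfK T.D T.K)).Vbad → Type}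
      [∀ v h, Monoid (Mv v h)]
      (sig : GlobalLGPFrobenioidSignature (thetaIndex (pilotDataOfK T.D T.K)).lstar (thetaIndex (pilotDataOfK T.D T.K)).V
        (· ∈ (thetaIndex (pilotDataOfK T.D T.K)).Vbad) Frd IsoF Ob realify Strip IsoS Mv)
      (split : SplittingMonoids Mv) {ObΔ : Type} {N : ∀ v : (thetaIndex (pilotDataOfK T.D T.K)).V, v ∈ (thetaIndex (pilotDataOfK T.D T.K)).Vbad → Type}
      [∀ v h, Monoid (N v h)] (qData : QPilotData ObΔ N)
      (tq : ∀ (pp : Nat.Primes) (x : (thetaIndex (pilotDataOfK T.D T.K)).Fibre (.inr pp)),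
        haveI : Fact (pp : ℕ).Prime := ⟨pp.2⟩; kOf (pilotDataOfK T.D T.K) pp.1 x)
      (t : ∀ (pp : Nat.Primes) (_ : Fin (pilotDataOfK T.D T.K).lstar) (x : (thetaIndex (pilotDataOfK T.D T.K)).Fibre (.inr pp)),
        haveI : Fact (pp : ℕ).Prime := ⟨pp.2⟩; kOf (pilotDataOfK T.D T.K) pp.1 x)
      (htq0 : ∀ pp x, tq pp x ≠ 0)
      (htq1 : ∀ (pp : Nat.Primes) (x : (thetaIndex (pilotDataOfK T.D T.K)).Fibre (.inr pp)),
        haveI : Fact (pp : ℕ).Prime := ⟨pp.2⟩; placeOf (pilotDataOfK T.D T.K) pp.1 x ∉ (pilotDataOfK T.D T.K).S → ‖tq pp x‖ = 1)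
      (_ht0 : ∀ pp i x, t pp i x ≠ 0)
      (_ht : ∀ (pp : Nat.Primes) (i : Fin (pilotDataOfK T.D T.K).lstar) (x : (thetaIndex (pilotDataOfK T.D T.K)).Fibre (.inr pp)),
        haveI : Fact (pp : ℕ).Prime := ⟨pp.2⟩
        Real.log ‖t pp i x‖ = -((pilotDataOfK T.D T.K).thetaPilot i (placeOf (pilotDataOfK T.D T.K) pp.1 x)) *
          logNorm T.K (placeOf (pilotDataOfK T.D T.K) pp.1 x) / localDegree T.K (placeOf (pilotDataOfK T.D T.K) pp.1 x))
      (_htq : ∀ (pp : Nat.Primes) (x : (thetaIndex (pilotDataOfK T.D T.K)).Fibre (.inr pp)),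
        haveI : Fact (pp : ℕ).Prime := ⟨pp.2⟩
        Real.log ‖tq pp x‖ = -((pilotDataOfK T.D T.K).qPilot (placeOf (pilotDataOfK T.D T.K) pp.1 x)) *
          logNorm T.K (placeOf (pilotDataOfK T.D T.K) pp.1 x) / localDegree T.K (placeOf (pilotDataOfK T.D T.K) pp.1 x)),
      ¬ Thm311ToCor312.Licence
        (settingPrVolSharp (pilotDataOfK T.D T.K) hlog M archPk archSub Ψ act Mmod region n lat sig split qData tq t htq0 htq1) := by
  letI := T.instFieldF; letI := T.instNumberFieldF; letI := T.instAlgebraF; letI := T.instFieldK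
  letI := T.instNumberFieldK; letI := T.instAlgebraK; letI := T.instFieldFbar; letI := T.instAlgebraFbar
  letI := T.instAlgebraKFbar; letI := T.instIsElliptic
  have hp : Nat.Prime 19 := by norm_num
  have hodd : l % 2 = 1 := hl.eq_two_or_odd.resolve_left (by omega)
  intro logv hlog M _ _ archPk archSub Ψ act Mmod region n HT LogLink IsFull lat Frd IsoF Ob realify Strip
    IsoS Mv _ sig split ObΔ N _ qData tq t htq0 htq1 ht0 ht htq
  exact WRow.not_licence_triple_of_hullCells_tame isABCTriple_frey1618481116086272 T ⟨19, hp⟩ (by norm_num) (by norm_num)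
    (by norm_num) (fun h => h19 h.symm) (by show (19 : ℕ) ∣ _; norm_num) WRow.factorization_frey1618481116086272_nineteen
    (i := (l - 1) / 2 - 1) (by omega)
    (fun A h30 h15 _ => by
      rcases WRow.refBandClass_nineteen_eleven h30 h15 with rfl | rfl
      · exact WRow.refBandCells_frey1618481116086272_nineteen_fifteen l h5 hhi hodd
      · exact WRow.refBandCells_frey1618481116086272_nineteen_thirty l h5 hhi hodd) hlog M archPk archSub Ψ act Mmod
    region n lat sig split qData tq t htq0 htq1 ht0 ht htq

/-- **… branch C's per-datum antecedent «∃ ρ qK, QPinned ∧ PilotKummerCompatHull» FAILS** at every genuine Θ-volume datum over `(ratPoint (a/c), l)`, every prime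
`5 ≤ l ≤ 148535`, `l ≠ 19`, for ANY columns and EVERY pair of realising ideles (`WRow.not_exists_qPinned_and_hull_triple_of_hullCells_tame`).
[cite: Mochizuki2012, IUTchIII Cor. 3.12 Step (xi-d) p. 183, (xi-f) p. 184] [cite: DupuyHilado2025, §3.4, §4.9, §4.12] [claim: Mochizuki2012, status: disputed] -/
theorem WRow.not_exists_qPinned_and_hull_frey1618481116086272_refBand {l : ℕ} (hl : l.Prime) (h5 : 5 ≤ l) (hhi : l ≤ 148535) (h19 : l ≠ 19)
    (T : Cor22.ThetaVolumeDatumAt (ratPoint (((2 ^ 46 * 23 : ℕ) : ℚ) / (19 ^ 11 * 59 * 7207 : ℕ))) l) :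
    letI := T.instFieldF; letI := T.instNumberFieldF; letI := T.instAlgebraF; letI := T.instFieldK
    letI := T.instNumberFieldK; letI := T.instAlgebraK; letI := T.instFieldFbar; letI := T.instAlgebraFbar
    letI := T.instAlgebraKFbar; letI := T.instIsElliptic
    ∀ {logv : PadicLogs T.K} (hlog : LogvAnalytic logv) (M : Type) [Field M] [NumberField M]
      (archPk : ∀ (j : (thetaIndex (pilotDataOfK T.D T.K)).Label) (vQ : (thetaIndex (pilotDataOfK T.D T.K)).VQ),
        Set ((logShellsDH (pilotDataOfK T.D T.K) logv).Packet j vQ))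
      (archSub : ∀ (j : (thetaIndex (pilotDataOfK T.D T.K)).Label) (v : (thetaIndex (pilotDataOfK T.D T.K)).V),
        Set ((logShellsDH (pilotDataOfK T.D T.K) logv).Packet j ((thetaIndex (pilotDataOfK T.D T.K)).over v)))
      (Ψ : ℤ → ∀ v : (thetaIndex (pilotDataOfK T.D T.K)).V, v ∈ (thetaIndex (pilotDataOfK T.D T.K)).Vbad →
        Set ((logShellsDH (pilotDataOfK T.D T.K) logv).StarPacket v))
      (act : ℤ → ∀ v : (thetaIndex (pilotDataOfK T.D T.K)).V, v ∈ (thetaIndex (pilotDataOfK T.D T.K)).Vbad →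
        (logShellsDH (pilotDataOfK T.D T.K) logv).StarPacket v → Module.End ℚ ((logShellsDH (pilotDataOfK T.D T.K) logv).StarPacket v))
      (Mmod : ℤ → ∀ j : (thetaIndex (pilotDataOfK T.D T.K)).LabelStar, Set ((logShellsDH (pilotDataOfK T.D T.K) logv).GlobalPacket j.1))
      (region : ℤ → ∀ j : (thetaIndex (pilotDataOfK T.D T.K)).LabelStar, FinDivisor M → ∀ vQ : (thetaIndex (pilotDataOfK T.D T.K)).VQ,
        Set ((logShellsDH (pilotDataOfK T.D T.K) logv).Packet j.1 vQ))
      (n : ℤ) {HT : Type} {LogLink : HT → HT → Type} {IsFull : ∀ {s t : HT}, LogLink s t → Prop}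
      (lat : LGPGaussianLogThetaLattice LogLink IsFull)
      {Frd : Type} {IsoF : Frd → Frd → Type} {Ob : Frd → Type} {realify : Frd → Frd} {Strip : Type}
      {IsoS : Strip → Strip → Type} {Mv : ∀ v : (thetaIndex (pilotDataOfK T.D T.K)).V, v ∈ (thetaIndex (pilotDataOfK T.D T.K)).Vbad → Type}
      [∀ v h, Monoid (Mv v h)]
      (sig : GlobalLGPFrobenioidSignature (thetaIndex (pilotDataOfK T.D T.K)).lstar (thetaIndex (pilotDataOfK T.D T.K)).V
        (· ∈ (thetaIndex (pilotDataOfK T.D T.K)).Vbad) Frd IsoF Ob realify Strip IsoS Mv)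
      (split : SplittingMonoids Mv) {ObΔ : Type} {N : ∀ v : (thetaIndex (pilotDataOfK T.D T.K)).V, v ∈ (thetaIndex (pilotDataOfK T.D T.K)).Vbad → Type}
      [∀ v h, Monoid (N v h)] (qData : QPilotData ObΔ N)
      (tq : ∀ (pp : Nat.Primes) (x : (thetaIndex (pilotDataOfK T.D T.K)).Fibre (.inr pp)),
        haveI : Fact (pp : ℕ).Prime := ⟨pp.2⟩; kOf (pilotDataOfK T.D T.K) pp.1 x)
      (t : ∀ (pp : Nat.Primes) (_ : Fin (pilotDataOfK T.D T.K).lstar) (x : (thetaIndex (pilotDataOfK T.D T.K)).Fibre (.inr pp)),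
        haveI : Fact (pp : ℕ).Prime := ⟨pp.2⟩; kOf (pilotDataOfK T.D T.K) pp.1 x)
      (htq0 : ∀ pp x, tq pp x ≠ 0)
      (htq1 : ∀ (pp : Nat.Primes) (x : (thetaIndex (pilotDataOfK T.D T.K)).Fibre (.inr pp)),
        haveI : Fact (pp : ℕ).Prime := ⟨pp.2⟩; placeOf (pilotDataOfK T.D T.K) pp.1 x ∉ (pilotDataOfK T.D T.K).S → ‖tq pp x‖ = 1)
      (col : ℤ → Column (logShellsDH (pilotDataOfK T.D T.K) logv))
      (_ht0 : ∀ pp i x, t pp i x ≠ 0)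
      (_ht : ∀ (pp : Nat.Primes) (i : Fin (pilotDataOfK T.D T.K).lstar) (x : (thetaIndex (pilotDataOfK T.D T.K)).Fibre (.inr pp)),
        haveI : Fact (pp : ℕ).Prime := ⟨pp.2⟩
        Real.log ‖t pp i x‖ = -((pilotDataOfK T.D T.K).thetaPilot i (placeOf (pilotDataOfK T.D T.K) pp.1 x)) *
          logNorm T.K (placeOf (pilotDataOfK T.D T.K) pp.1 x) / localDegree T.K (placeOf (pilotDataOfK T.D T.K) pp.1 x))
      (_htq : ∀ (pp : Nat.Primes) (x : (thetaIndex (pilotDataOfK T.D T.K)).Fibre (.inr pp)),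
        haveI : Fact (pp : ℕ).Prime := ⟨pp.2⟩
        Real.log ‖tq pp x‖ = -((pilotDataOfK T.D T.K).qPilot (placeOf (pilotDataOfK T.D T.K) pp.1 x)) *
          logNorm T.K (placeOf (pilotDataOfK T.D T.K) pp.1 x) / localDegree T.K (placeOf (pilotDataOfK T.D T.K) pp.1 x)),
      ¬ ∃ (ρ : (∀ v : (thetaIndex (pilotDataOfK T.D T.K)).V, v ∈ (thetaIndex (pilotDataOfK T.D T.K)).Vbad →
              Set ((logShellsDH (pilotDataOfK T.D T.K) logv).StarPacket v)) →
            ∀ (j : (thetaIndex (pilotDataOfK T.D T.K)).Label) (vQ : (thetaIndex (pilotDataOfK T.D T.K)).VQ),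
              Set ((logShellsDH (pilotDataOfK T.D T.K) logv).Packet j vQ))
          (qK : ∀ v : (thetaIndex (pilotDataOfK T.D T.K)).V, v ∈ (thetaIndex (pilotDataOfK T.D T.K)).Vbad →
            Set ((logShellsDH (pilotDataOfK T.D T.K) logv).StarPacket v)),
          QPinned ({ toSituation := situationPrVol (pilotDataOfK T.D T.K) hlog M archPk archSub Ψ act Mmod region, col := col } :
              LatticeSituation (thetaIndex (pilotDataOfK T.D T.K)))
            (settingPrVolSharp (pilotDataOfK T.D T.K) hlog M archPk archSub Ψ act Mmod region n lat sig split qData tq t htq0 htq1) ρ qK ∧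
          PilotKummerCompatHull ({ toSituation := situationPrVol (pilotDataOfK T.D T.K) hlog M archPk archSub Ψ act Mmod region, col := col } :
              LatticeSituation (thetaIndex (pilotDataOfK T.D T.K)))
            (settingPrVolSharp (pilotDataOfK T.D T.K) hlog M archPk archSub Ψ act Mmod region n lat sig split qData tq t htq0 htq1) ρ qK := by
  letI := T.instFieldF; letI := T.instNumberFieldF; letI := T.instAlgebraF; letI := T.instFieldK
  letI := T.instNumberFieldK; letI := T.instAlgebraK; letI := T.instFieldFbar; letI := T.instAlgebraFbar
  letI := T.instAlgebraKFbar; letI := T.instIsElliptic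
  have hp : Nat.Prime 19 := by norm_num
  have hodd : l % 2 = 1 := hl.eq_two_or_odd.resolve_left (by omega)
  intro logv hlog M _ _ archPk archSub Ψ act Mmod region n HT LogLink IsFull lat Frd IsoF Ob realify Strip
    IsoS Mv _ sig split ObΔ N _ qData tq t htq0 htq1 col ht0 ht htq
  exact WRow.not_exists_qPinned_and_hull_triple_of_hullCells_tame isABCTriple_frey1618481116086272 T ⟨19, hp⟩ (by norm_num) (by norm_num)
    (by norm_num) (fun h => h19 h.symm) (by show (19 : ℕ) ∣ _; norm_num) WRow.factorization_frey1618481116086272_nineteen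
    (i := (l - 1) / 2 - 1) (by omega)
    (fun A h30 h15 _ => by
      rcases WRow.refBandClass_nineteen_eleven h30 h15 with rfl | rfl
      · exact WRow.refBandCells_frey1618481116086272_nineteen_fifteen l h5 hhi hodd
      · exact WRow.refBandCells_frey1618481116086272_nineteen_thirty l h5 hhi hodd) hlog M archPk archSub Ψ act Mmod
    region n lat sig split qData tq t htq0 htq1 col ht0 ht htq

/-- **… and in the W-lane ROW SHAPE (R-W rows `pilotDataOfK:frey-1618481116086272-…:l`, EVERY prime `5 ≤ l ≤ 148535`, `l ≠ 19` — REFUTED side, UNCONDITIONALLY,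
over the WHOLE kernel class of local types)**: for every genuine Θ-volume datum `T` over `(ratPoint (a/c), l)` and EVERY choice of the free context binders and
Kummer datum, `Cor312Vol.PilotKummerCompatHull` at `settingPrVolSharp (pilotDataOfK T.D T.K) …` with the CHOSEN realising ideles and the PINNED reading FAILS
(`GenuineK.not_pilotKummerCompatHull_chosen_triple_of_hullCells_tame`). Admissibility / Szpiro-badness / (P6) / non-emptiness NOT claimed.
[cite: Mochizuki2012, IUTchIII Cor. 3.12 Step (xi-f) p. 184; IUTchIV Prop. 1.1 p. 9, Prop. 1.2 (i)(ii) p. 10] [cite: DupuyHilado2025, §3.4, §4.9, §4.12]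
[claim: Mochizuki2012, status: disputed] -/
theorem GenuineK.not_pilotKummerCompatHull_chosen_frey1618481116086272_refBand {l : ℕ} (hl : l.Prime) (h5 : 5 ≤ l) (hhi : l ≤ 148535)
    (h19 : l ≠ 19) (T : Cor22.ThetaVolumeDatumAt (ratPoint (((2 ^ 46 * 23 : ℕ) : ℚ) / (19 ^ 11 * 59 * 7207 : ℕ))) l) :
    letI := T.instFieldF; letI := T.instNumberFieldF; letI := T.instAlgebraF; letI := T.instFieldK
    letI := T.instNumberFieldK; letI := T.instAlgebraK; letI := T.instFieldFbar; letI := T.instAlgebraFbar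
    letI := T.instAlgebraKFbar; letI := T.instIsElliptic
    ∀ (M : Type) [Field M] [NumberField M]
      (archPk : ∀ (j : (thetaIndex (pilotDataOfK T.D T.K)).Label) (vQ : (thetaIndex (pilotDataOfK T.D T.K)).VQ),
        Set ((logShellsDH (pilotDataOfK T.D T.K) (analyticLogv T.K)).Packet j vQ))
      (archSub : ∀ (j : (thetaIndex (pilotDataOfK T.D T.K)).Label) (v : (thetaIndex (pilotDataOfK T.D T.K)).V),
        Set ((logShellsDH (pilotDataOfK T.D T.K) (analyticLogv T.K)).Packet j ((thetaIndex (pilotDataOfK T.D T.K)).over v)))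
      (Ψ : ℤ → ∀ v : (thetaIndex (pilotDataOfK T.D T.K)).V, v ∈ (thetaIndex (pilotDataOfK T.D T.K)).Vbad →
        Set ((logShellsDH (pilotDataOfK T.D T.K) (analyticLogv T.K)).StarPacket v))
      (act : ℤ → ∀ v : (thetaIndex (pilotDataOfK T.D T.K)).V, v ∈ (thetaIndex (pilotDataOfK T.D T.K)).Vbad →
        (logShellsDH (pilotDataOfK T.D T.K) (analyticLogv T.K)).StarPacket v →
          Module.End ℚ ((logShellsDH (pilotDataOfK T.D T.K) (analyticLogv T.K)).StarPacket v))
      (Mmod : ℤ → ∀ j : (thetaIndex (pilotDataOfK T.D T.K)).LabelStar,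
        Set ((logShellsDH (pilotDataOfK T.D T.K) (analyticLogv T.K)).GlobalPacket j.1))
      (region : ℤ → ∀ j : (thetaIndex (pilotDataOfK T.D T.K)).LabelStar, FinDivisor M →
        ∀ vQ : (thetaIndex (pilotDataOfK T.D T.K)).VQ, Set ((logShellsDH (pilotDataOfK T.D T.K) (analyticLogv T.K)).Packet j.1 vQ))
      (frobAdm : ℤ → ℤ → ∀ (j : (thetaIndex (pilotDataOfK T.D T.K)).Label) (vQ : (thetaIndex (pilotDataOfK T.D T.K)).VQ),
        Set ((logShellsDH (pilotDataOfK T.D T.K) (analyticLogv T.K)).Packet j vQ) → Prop)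
      (frobLogvol : ℤ → ℤ → ∀ (j : (thetaIndex (pilotDataOfK T.D T.K)).Label) (vQ : (thetaIndex (pilotDataOfK T.D T.K)).VQ),
        Set ((logShellsDH (pilotDataOfK T.D T.K) (analyticLogv T.K)).Packet j vQ) → ℝ)
      (frobΨ : ℤ → ℤ → ∀ v : (thetaIndex (pilotDataOfK T.D T.K)).V, v ∈ (thetaIndex (pilotDataOfK T.D T.K)).Vbad →
        Set ((logShellsDH (pilotDataOfK T.D T.K) (analyticLogv T.K)).StarPacket v))
      (frobMmod : ℤ → ℤ → ∀ j : (thetaIndex (pilotDataOfK T.D T.K)).LabelStar,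
        Set ((logShellsDH (pilotDataOfK T.D T.K) (analyticLogv T.K)).GlobalPacket j.1))
      (unitImage : ℤ → ℤ → ℕ → ∀ (j : (thetaIndex (pilotDataOfK T.D T.K)).Label) (vQ : (thetaIndex (pilotDataOfK T.D T.K)).VQ),
        Set ((logShellsDH (pilotDataOfK T.D T.K) (analyticLogv T.K)).Packet j vQ))
      (ballImage : ℤ → ℤ → ∀ (j : (thetaIndex (pilotDataOfK T.D T.K)).Label) (vQ : (thetaIndex (pilotDataOfK T.D T.K)).VQ),
        Set ((logShellsDH (pilotDataOfK T.D T.K) (analyticLogv T.K)).Packet j vQ))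
      (thetaDiv : ℤ → ℤ → LgpDivisor M (thetaIndex (pilotDataOfK T.D T.K)).lstar)
      (n : ℤ) {HT : Type} {LogLink : HT → HT → Type} {IsFull : ∀ {s t : HT}, LogLink s t → Prop}
      (lat : LGPGaussianLogThetaLattice LogLink IsFull)
      {Frd : Type} {IsoF : Frd → Frd → Type} {Ob : Frd → Type} {realify : Frd → Frd} {Strip : Type}
      {IsoS : Strip → Strip → Type} {Mv : ∀ v : (thetaIndex (pilotDataOfK T.D T.K)).V, v ∈ (thetaIndex (pilotDataOfK T.D T.K)).Vbad → Type}
      [∀ v h, Monoid (Mv v h)]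
      (sig : GlobalLGPFrobenioidSignature (thetaIndex (pilotDataOfK T.D T.K)).lstar (thetaIndex (pilotDataOfK T.D T.K)).V
        (· ∈ (thetaIndex (pilotDataOfK T.D T.K)).Vbad) Frd IsoF Ob realify Strip IsoS Mv)
      (split : SplittingMonoids Mv) {ObΔ : Type}
      {N : ∀ v : (thetaIndex (pilotDataOfK T.D T.K)).V, v ∈ (thetaIndex (pilotDataOfK T.D T.K)).Vbad → Type}
      [∀ v h, Monoid (N v h)] (qData : QPilotData ObΔ N)
      (qK : ∀ v : (thetaIndex (pilotDataOfK T.D T.K)).V, v ∈ (thetaIndex (pilotDataOfK T.D T.K)).Vbad →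
        Set ((logShellsDH (pilotDataOfK T.D T.K) (analyticLogv T.K)).StarPacket v)),
    ¬ Cor312Vol.PilotKummerCompatHull
        (LatticeSituation.ofShells (logShellsDH (pilotDataOfK T.D T.K) (analyticLogv T.K)) M archPk archSub
          (summandPiecesPr (pilotDataOfK T.D T.K) (logvAnalytic_analyticLogv (F := T.K))).Adm
          (summandPiecesPr (pilotDataOfK T.D T.K) (logvAnalytic_analyticLogv (F := T.K))).logvol Ψ act Mmod region frobAdm
          frobLogvol frobΨ frobMmod unitImage ballImage thetaDiv)
        (settingPrVolSharp (pilotDataOfK T.D T.K) (logvAnalytic_analyticLogv (F := T.K)) M archPk archSub Ψ act Mmod region n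
          lat sig split qData (exists_realising_qIdeles_pilotDataOfK T.D).choose (exists_realising_thetaIdeles_pilotDataOfK T.D).choose
          (exists_realising_qIdeles_pilotDataOfK T.D).choose_spec.1 (exists_realising_qIdeles_pilotDataOfK T.D).choose_spec.2.1)
        (fun _ => Cor312.Setting.qRegion
          (settingPrVolSharp (pilotDataOfK T.D T.K) (logvAnalytic_analyticLogv (F := T.K)) M archPk archSub Ψ act Mmod region n
            lat sig split qData (exists_realising_qIdeles_pilotDataOfK T.D).choose (exists_realising_thetaIdeles_pilotDataOfK T.D).choose
            (exists_realising_qIdeles_pilotDataOfK T.D).choose_spec.1 (exists_realising_qIdeles_pilotDataOfK T.D).choose_spec.2.1))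
        qK := by
  letI := T.instFieldF; letI := T.instNumberFieldF; letI := T.instAlgebraF; letI := T.instFieldK
  letI := T.instNumberFieldK; letI := T.instAlgebraK; letI := T.instFieldFbar; letI := T.instAlgebraFbar
  letI := T.instAlgebraKFbar; letI := T.instIsElliptic
  have hp : Nat.Prime 19 := by norm_num
  have hodd : l % 2 = 1 := hl.eq_two_or_odd.resolve_left (by omega)
  intro M _ _ archPk archSub Ψ act Mmod region frobAdm frobLogvol frobΨ frobMmod
    unitImage ballImage thetaDiv n HT LogLink IsFull lat Frd IsoF Ob realify Strip IsoS Mv _ sig split ObΔ N _ qData qK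
  exact GenuineK.not_pilotKummerCompatHull_chosen_triple_of_hullCells_tame isABCTriple_frey1618481116086272 T ⟨19, hp⟩ (by norm_num)
    (by norm_num) (by norm_num) (fun h => h19 h.symm) (by show (19 : ℕ) ∣ _; norm_num) WRow.factorization_frey1618481116086272_nineteen
    (i := (l - 1) / 2 - 1) (by omega)
    (fun A h30 h15 _ => by
      rcases WRow.refBandClass_nineteen_eleven h30 h15 with rfl | rfl
      · exact WRow.refBandCells_frey1618481116086272_nineteen_fifteen l h5 hhi hodd
      · exact WRow.refBandCells_frey1618481116086272_nineteen_thirty l h5 hhi hodd) M archPk archSub Ψ act Mmod region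
    frobAdm frobLogvol frobΨ frobMmod unitImage ballImage thetaDiv n lat sig split qData qK

end Summit.ABC.IUTFork.Conditional

end
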